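import Summits.ResolutionOfSingularities.ResolutionOfSingularities.Theorems.HomologicalConductorNoZenoBirthDefs
import Summits.ResolutionOfSingularities.ResolutionOfSingularities.Theorems.HomologicalConductorNoZenoNoetherianCase
import HarnessLib

/-!
# Crux `NoZeno` (stmt-ResolutionOfSingularities-16483), line `birth` (v3) — stub `stub_relativeACC`

Route `ResolutionOfSingularities/HomologicalConductor`, crux
`Summit.ResolutionOfSingularities.ResolutionOfSingularities.Theses.HomologicalConductor.NoZeno`.
Registered stub of the line `birth` (skeleton v3):

  `StrictDrop` alone terminates the canonical normalised `ca`-tower along `O` as soon as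
  (i) some `ca(T_m₀)` contains a nonzero `c` with `c⁻¹ ∈ U` for an overring `U ≥ O`, and
  (ii) `O` has no infinite strictly ascending chain of principal ideals `(z₀) ⊊ (z₁) ⊊ ⋯`
  generated by `U`-units (every sequence `zₙ ∈ O ∖ 0` with `zₙ⁻¹ ∈ U` and `zₙ · zₙ₊₁⁻¹ ∈ O`
  for all `n` has some `n` with `zₙ₊₁ · zₙ⁻¹ ∈ O`).

Proof: were every stage singular, iterate `StrictDrop` from `z₀ = c`: the drop `y ∈ ca(T_m')`
with `y · zₙ⁻¹ ∉ O` has `zₙ · y⁻¹ ∈ O` (`O` is a valuation ring), hence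
`y⁻¹ = zₙ⁻¹ · (zₙ · y⁻¹) ∈ U`; the `zₙ` (all in `O`, since `ca(T_m) ⊆ T_m ⊆ O`,
`ca_tower_subset_valuationSubring`) form a chain forbidden by (ii). With `U = O` noetherian this
is `stub_noetherianCase`; only the units of the coarsening `U` and the chain condition relative
to `U` are used. `Persistence` is not used; `A.FG` and `IsFractionRing` only feed `StrictDrop`.
-/

noncomputable section

-- single-problem summit: the doubled namespace component `ResolutionOfSingularities` is forced
set_option linter.dupNamespace false

namespace Summit.ResolutionOfSingularities.ResolutionOfSingularities.Theorems.NoZeno.Birth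

open Summit.ResolutionOfSingularities.ResolutionOfSingularities.Theses.HomologicalConductor

/-! ## The registered stub -/

/-- **STUB `stub_relativeACC` (line `birth` of crux `NoZeno`, v3).** `StrictDrop` alone
terminates the canonical normalised `ca`-tower along `O` as soon as (i) some `ca(T_m₀)` contains
a nonzero `c` with `c⁻¹ ∈ U` for an overring `U ≥ O`, and (ii) `O` has no infinite strictly
ascending chain of principal ideals `(z₀) ⊊ (z₁) ⊊ ⋯` with all `zₙ⁻¹ ∈ U`. Proof: were every
stage singular, iterate `StrictDrop` from `z₀ = c`: the drop `y ∈ ca(T_m')` with `y · zₙ⁻¹ ∉ O`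
has `zₙ · y⁻¹ ∈ O`, hence `y⁻¹ = zₙ⁻¹ · (zₙ · y⁻¹) ∈ U`; the `zₙ` form a chain forbidden by
(ii). With `U = O` noetherian this is `stub_noetherianCase`; the point is that only the units of
the COARSENING `U` and the chain condition relative to `U` are used.
[cite: ZariskiSamuel1960, Ch. VI §10] -/
theorem stub_relativeACC (hD : StrictDrop) (p : ℕ) (hp : p.Prime) (k K : Type) [Field k]
    [CharP k p] [Field K] [Algebra k K] (O : ValuationSubring K) (A : Subalgebra k K)
    (hk : ∀ c : k, algebraMap k K c ∈ O) (hA : A.FG) (hfr : IsFractionRing ↥A K)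
    (hAO : A.toSubring ≤ O.toSubring) (U : ValuationSubring K) (hOU : O ≤ U)
    (hunit : ∃ m : ℕ, ∃ c ∈ ca (tower O A m), c ≠ 0 ∧ c⁻¹ ∈ U)
    (hacc : ∀ z : ℕ → K, (∀ n : ℕ, z n ∈ O ∧ z n ≠ 0 ∧ (z n)⁻¹ ∈ U) →
      (∀ n : ℕ, z n * (z (n + 1))⁻¹ ∈ O) → ∃ n : ℕ, z (n + 1) * (z n)⁻¹ ∈ O) :
    ∃ m : ℕ, IsRegularLocalRing ↥(tower O A m) := by
  -- `StrictDrop` specialised to the named tower (definitional unfolding of its `let`s)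
  have hdrop : ∀ m : ℕ, ¬ IsRegularLocalRing ↥(tower O A m) → ∃ m' : ℕ, m < m' ∧
      ∃ y ∈ ca (tower O A m'), y ≠ 0 ∧ ∀ x ∈ ca (tower O A m), x ≠ 0 → y * x⁻¹ ∉ O :=
    hD p hp k K O A hk hA hfr hAO
  by_contra hcon
  push Not at hcon
  -- one drop from a good state `(m, x)` (`x ∈ ca(T_m)`, `x ≠ 0`, `x⁻¹ ∈ U`) to a good state
  -- `(m', y)` with `y * x⁻¹ ∉ O`
  have hstep : ∀ q : {q : ℕ × K // q.2 ∈ ca (tower O A q.1) ∧ q.2 ≠ 0 ∧ q.2⁻¹ ∈ U},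
      ∃ q' : {q : ℕ × K // q.2 ∈ ca (tower O A q.1) ∧ q.2 ≠ 0 ∧ q.2⁻¹ ∈ U},
        q'.1.2 * (q.1.2)⁻¹ ∉ O := by
    rintro ⟨⟨m, x⟩, hx, hx0, hxU⟩
    obtain ⟨m', -, y, hy, hy0, hlt⟩ := hdrop m (hcon m)
    have h1 : y * x⁻¹ ∉ O := hlt x hx hx0
    have h2 : x * y⁻¹ ∈ O := by
      rcases O.mem_or_inv_mem (y * x⁻¹) with h | h
      · exact absurd h h1
      · rwa [mul_inv_rev, inv_inv] at h
    have h3 : y⁻¹ ∈ U := by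
      have h4 : x⁻¹ * (x * y⁻¹) ∈ U := U.mul_mem _ _ hxU (hOU h2)
      rwa [inv_mul_cancel_left₀ hx0] at h4
    exact ⟨⟨(m', y), hy, hy0, h3⟩, h1⟩
  choose F hF using hstep
  obtain ⟨m₀, c, hc, hc0, hcU⟩ := hunit
  -- iterate the drop from `(m₀, c)`
  obtain ⟨s, hs⟩ : ∃ s : ℕ → {q : ℕ × K // q.2 ∈ ca (tower O A q.1) ∧ q.2 ≠ 0 ∧ q.2⁻¹ ∈ U},
      ∀ n : ℕ, s (n + 1) = F (s n) :=
    ⟨fun n => Nat.rec ⟨(m₀, c), hc, hc0, hcU⟩ (fun _ q => F q) n, fun _ => rfl⟩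
  obtain ⟨n, hn⟩ := hacc (fun n => (s n).1.2)
    (fun n => ⟨ca_tower_subset_valuationSubring O hk hAO (s n).1.1 (s n).2.1, (s n).2.2.1,
      (s n).2.2.2⟩)
    (fun n => by
      rcases O.mem_or_inv_mem ((F (s n)).1.2 * ((s n).1.2)⁻¹) with h | h
      · exact absurd h (hF (s n))
      · rw [mul_inv_rev, inv_inv] at h
        show (s n).1.2 * ((s (n + 1)).1.2)⁻¹ ∈ O
        rw [hs n]
        exact h)
  have hn' : (s (n + 1)).1.2 * ((s n).1.2)⁻¹ ∈ O := hn
  rw [hs n] at hn'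
  exact hF (s n) hn'

end Summit.ResolutionOfSingularities.ResolutionOfSingularities.Theorems.NoZeno.Birth

end
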